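import Mathlib
import Summits.Ventures.PercRepro2.Defs
import Summits.Ventures.PercRepro2.Independence
import Summits.Ventures.PercRepro2.Harris
import Summits.Ventures.PercRepro2.ThreeEventSafe
import Summits.Ventures.PercRepro2.ThreeEventCross
import Summits.Ventures.PercRepro2.ThreeEventCertificate
import Summits.Ventures.PercRepro2.ThreeEventCertificateSwap
import Summits.Ventures.PercRepro2.ThreeEventCertificateInduction
import Summits.Ventures.PercRepro2.ThreeEventAD

/-!
# Certificates with Ahlswede–Daykin terms (blind cell PercRepro2, p4 g33; proofs/P4-G33-CROSS.md §4f)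

Besides the symmetrised pair weights of admissible instances (nonnegative expectation by the induction
hypothesis), a pointwise certificate for the cross term may use AHLSWEDE–DAYKIN TERMS
`a(ω, ω') = 1_D(ω)·1_C(ω') − 1_X(ω)·1_Y(ω')` for sets `X, Y, C, D` with `x ⊓ y ∈ C` and `x ⊔ y ∈ D` for
all `x ∈ X`, `y ∈ Y`: their expectation `P(D)P(C) − P(X)P(Y)` is nonnegative by the four functions
theorem (`prob_mul_prob_le_of_inf_sup`, ThreeEventAD), for every weight vector, with no induction.
**`defect_nonneg_of_sym_certificates_ad`** is the certificate induction of ThreeEventCertificateInduction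
with two such terms allowed; **`cov_inter_le_cov_of_sym_certificates_ad`** is the instance for the
admissible quadruples. The n = 5 instance `G = ↑{ab,bc,ad,cd,e}`, `H = ↑{ac,ad,bd,bce}`, `B = ↓{bce,ade}`,
whose edges a, b, c, d have no certificate without such terms, is certified at each of them by
`Ψ₀ + Ψ₁ + AD(N₀, S₁)` (P4-G33-CROSS §4f). No definition, no instance, no notation.
-/

namespace Summit.Ventures.PercRepro2

namespace ThreeEvent

section AD

variable {E : Type*} [Fintype E] [DecidableEq E] {R : Type*} [CommRing R] [LinearOrder R]
  [IsStrictOrderedRing R]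

/-- An Ahlswede–Daykin term has nonnegative double sum: `Σ w(ω) w(ω') (1_D(ω) 1_C(ω') − 1_X(ω) 1_Y(ω'))
= P(D)P(C) − P(X)P(Y) ≥ 0` whenever meets of `X × Y` lie in `C` and joins in `D`. -/
lemma ad_double_sum_nonneg {p : E → R} (hp : IsProbVec p) {X Y C D : Set (Config E)}
    (h : ∀ a ∈ X, ∀ b ∈ Y, a ⊓ b ∈ C ∧ a ⊔ b ∈ D) :
    0 ≤ ∑ ω, ∑ ω', weight p ω * weight p ω'
        * (D.indicator (1 : Config E → R) ω * C.indicator 1 ω'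
            - X.indicator (1 : Config E → R) ω * Y.indicator 1 ω') := by
  have hAD := prob_mul_prob_le_of_inf_sup hp h
  rw [prob_mul_prob_eq_double_sum p p X Y, mul_comm (prob p C) (prob p D),
    prob_mul_prob_eq_double_sum p p D C] at hAD
  have : ∑ ω, ∑ ω', weight p ω * weight p ω'
        * (D.indicator (1 : Config E → R) ω * C.indicator 1 ω'
            - X.indicator (1 : Config E → R) ω * Y.indicator 1 ω')
      = (∑ ω, ∑ ω', weight p ω * weight p ω' * (D.indicator (1 : Config E → R) ω * C.indicator 1 ω'))
        - ∑ ω, ∑ ω', weight p ω * weight p ω' * (X.indicator (1 : Config E → R) ω * Y.indicator 1 ω') := by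
    rw [← Finset.sum_sub_distrib]
    refine Finset.sum_congr rfl fun ω _ => ?_
    rw [← Finset.sum_sub_distrib]
    refine Finset.sum_congr rfl fun ω' _ => ?_
    ring
  rw [this]
  linarith

/-- The symmetrised Ahlswede–Daykin term also has nonnegative double sum. -/
lemma ad_double_sum_sym_nonneg {p : E → R} (hp : IsProbVec p) {X Y C D : Set (Config E)}
    (h : ∀ a ∈ X, ∀ b ∈ Y, a ⊓ b ∈ C ∧ a ⊔ b ∈ D) :
    0 ≤ ∑ ω, ∑ ω', weight p ω * weight p ω'
        * ((D.indicator (1 : Config E → R) ω * C.indicator 1 ω'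
            - X.indicator (1 : Config E → R) ω * Y.indicator 1 ω')
          + (D.indicator (1 : Config E → R) ω' * C.indicator 1 ω
            - X.indicator (1 : Config E → R) ω' * Y.indicator 1 ω)) := by
  have h1 := ad_double_sum_nonneg hp h
  have h2 : 0 ≤ ∑ ω, ∑ ω', weight p ω * weight p ω'
      * (D.indicator (1 : Config E → R) ω' * C.indicator 1 ω
          - X.indicator (1 : Config E → R) ω' * Y.indicator 1 ω) := by
    have := ad_double_sum_nonneg hp h
    rw [Finset.sum_comm] at this
    refine this.trans (le_of_eq ?_)
    refine Finset.sum_congr rfl fun ω _ => Finset.sum_congr rfl fun ω' _ => ?_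
    ring
  have : ∑ ω, ∑ ω', weight p ω * weight p ω'
        * ((D.indicator (1 : Config E → R) ω * C.indicator 1 ω'
            - X.indicator (1 : Config E → R) ω * Y.indicator 1 ω')
          + (D.indicator (1 : Config E → R) ω' * C.indicator 1 ω
            - X.indicator (1 : Config E → R) ω' * Y.indicator 1 ω))
      = (∑ ω, ∑ ω', weight p ω * weight p ω'
          * (D.indicator (1 : Config E → R) ω * C.indicator 1 ω'
              - X.indicator (1 : Config E → R) ω * Y.indicator 1 ω'))
        + ∑ ω, ∑ ω', weight p ω * weight p ω'
          * (D.indicator (1 : Config E → R) ω' * C.indicator 1 ω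
              - X.indicator (1 : Config E → R) ω' * Y.indicator 1 ω) := by
    rw [← Finset.sum_add_distrib]
    refine Finset.sum_congr rfl fun ω _ => ?_
    rw [← Finset.sum_add_distrib]
    refine Finset.sum_congr rfl fun ω' _ => ?_
    ring
  rw [this]
  linarith

/-- **Symmetrised certificates with two Ahlswede–Daykin terms.** -/
theorem crossTerm_ge_of_pointwise_sym_ad {p : E → R} (hp : IsProbVec p) (e : E)
    (G H M B G₁ H₁ M₁ B₁ G₂ H₂ M₂ B₂ X₁ Y₁ C₁ D₁ X₂ Y₂ C₂ D₂ : Set (Config E))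
    (hAD₁ : ∀ a ∈ X₁, ∀ b ∈ Y₁, a ⊓ b ∈ C₁ ∧ a ⊔ b ∈ D₁)
    (hAD₂ : ∀ a ∈ X₂, ∀ b ∈ Y₂, a ⊓ b ∈ C₂ ∧ a ⊔ b ∈ D₂)
    (l₁ l₂ m₁ m₂ : R) (hm₁ : 0 ≤ m₁) (hm₂ : 0 ≤ m₂)
    (hcert : ∀ ω ω' : Config E, ω e = true → ω' e = true →
      l₁ * (pairWt G₁ H₁ M₁ B₁ ω ω' + pairWt G₁ H₁ M₁ B₁ ω' ω)
        + l₂ * (pairWt G₂ H₂ M₂ B₂ ω ω' + pairWt G₂ H₂ M₂ B₂ ω' ω)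
        + m₁ * ((D₁.indicator (1 : Config E → R) ω * C₁.indicator 1 ω'
                  - X₁.indicator (1 : Config E → R) ω * Y₁.indicator 1 ω')
                + (D₁.indicator (1 : Config E → R) ω' * C₁.indicator 1 ω
                  - X₁.indicator (1 : Config E → R) ω' * Y₁.indicator 1 ω))
        + m₂ * ((D₂.indicator (1 : Config E → R) ω * C₂.indicator 1 ω'
                  - X₂.indicator (1 : Config E → R) ω * Y₂.indicator 1 ω')
                + (D₂.indicator (1 : Config E → R) ω' * C₂.indicator 1 ω
                  - X₂.indicator (1 : Config E → R) ω' * Y₂.indicator 1 ω))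
        ≤ (pairWt G H M B (Function.update ω e false) ω'
            + pairWt G H M B ω (Function.update ω' e false))
          + (pairWt G H M B (Function.update ω' e false) ω
            + pairWt G H M B ω' (Function.update ω e false))) :
    2 * (l₁ * defect (Function.update p e 1) G₁ H₁ M₁ B₁
      + l₂ * defect (Function.update p e 1) G₂ H₂ M₂ B₂) ≤ 2 * crossTerm p e G H M B := by
  have hq : IsProbVec (Function.update p e 1) := hp.update e zero_le_one le_rfl
  have hA1 := ad_double_sum_sym_nonneg hq hAD₁
  have hA2 := ad_double_sum_sym_nonneg hq hAD₂
  rw [mul_add, mul_left_comm, mul_left_comm (2 : R), two_mul_defect_eq', two_mul_defect_eq',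
    two_mul_crossTerm_eq']
  -- the certificate, summed against the nonnegative weights, bounds the cross term by the defects
  -- plus the two AD sums, which are nonnegative
  have hsum : ∑ ω, ∑ ω', weight (Function.update p e 1) ω * weight (Function.update p e 1) ω'
        * (l₁ * (pairWt G₁ H₁ M₁ B₁ ω ω' + pairWt G₁ H₁ M₁ B₁ ω' ω)
          + l₂ * (pairWt G₂ H₂ M₂ B₂ ω ω' + pairWt G₂ H₂ M₂ B₂ ω' ω)
          + m₁ * ((D₁.indicator (1 : Config E → R) ω * C₁.indicator 1 ω'
                    - X₁.indicator (1 : Config E → R) ω * Y₁.indicator 1 ω')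
                  + (D₁.indicator (1 : Config E → R) ω' * C₁.indicator 1 ω
                    - X₁.indicator (1 : Config E → R) ω' * Y₁.indicator 1 ω))
          + m₂ * ((D₂.indicator (1 : Config E → R) ω * C₂.indicator 1 ω'
                    - X₂.indicator (1 : Config E → R) ω * Y₂.indicator 1 ω')
                  + (D₂.indicator (1 : Config E → R) ω' * C₂.indicator 1 ω
                    - X₂.indicator (1 : Config E → R) ω' * Y₂.indicator 1 ω)))
      ≤ ∑ ω, ∑ ω', weight (Function.update p e 1) ω * weight (Function.update p e 1) ω'
          * ((pairWt G H M B (Function.update ω e false) ω'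
              + pairWt G H M B ω (Function.update ω' e false))
            + (pairWt G H M B (Function.update ω' e false) ω
              + pairWt G H M B ω' (Function.update ω e false))) := by
    refine Finset.sum_le_sum fun ω _ => Finset.sum_le_sum fun ω' _ => ?_
    have hw : 0 ≤ weight (Function.update p e 1) ω * weight (Function.update p e 1) ω' :=
      mul_nonneg (weight_nonneg hq ω) (weight_nonneg hq ω')
    by_cases h : ω e = true
    · by_cases h' : ω' e = true
      · exact mul_le_mul_of_nonneg_left (hcert ω ω' h h') hw
      · have h'' : ω' e = false := by simpa using h'
        rw [weight_update_one_eq_zero_of_false p h'']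
        simp
    · have h'' : ω e = false := by simpa using h
      rw [weight_update_one_eq_zero_of_false p h'']
      simp
  -- split the left-hand double sum into its four parts
  have hsplit : ∑ ω, ∑ ω', weight (Function.update p e 1) ω * weight (Function.update p e 1) ω'
        * (l₁ * (pairWt G₁ H₁ M₁ B₁ ω ω' + pairWt G₁ H₁ M₁ B₁ ω' ω)
          + l₂ * (pairWt G₂ H₂ M₂ B₂ ω ω' + pairWt G₂ H₂ M₂ B₂ ω' ω)
          + m₁ * ((D₁.indicator (1 : Config E → R) ω * C₁.indicator 1 ω'
                    - X₁.indicator (1 : Config E → R) ω * Y₁.indicator 1 ω')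
                  + (D₁.indicator (1 : Config E → R) ω' * C₁.indicator 1 ω
                    - X₁.indicator (1 : Config E → R) ω' * Y₁.indicator 1 ω))
          + m₂ * ((D₂.indicator (1 : Config E → R) ω * C₂.indicator 1 ω'
                    - X₂.indicator (1 : Config E → R) ω * Y₂.indicator 1 ω')
                  + (D₂.indicator (1 : Config E → R) ω' * C₂.indicator 1 ω
                    - X₂.indicator (1 : Config E → R) ω' * Y₂.indicator 1 ω)))
      = l₁ * ∑ ω, ∑ ω', weight (Function.update p e 1) ω * weight (Function.update p e 1) ω'
            * (pairWt G₁ H₁ M₁ B₁ ω ω' + pairWt G₁ H₁ M₁ B₁ ω' ω)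
        + l₂ * ∑ ω, ∑ ω', weight (Function.update p e 1) ω * weight (Function.update p e 1) ω'
            * (pairWt G₂ H₂ M₂ B₂ ω ω' + pairWt G₂ H₂ M₂ B₂ ω' ω)
        + m₁ * ∑ ω, ∑ ω', weight (Function.update p e 1) ω * weight (Function.update p e 1) ω'
            * ((D₁.indicator (1 : Config E → R) ω * C₁.indicator 1 ω'
                  - X₁.indicator (1 : Config E → R) ω * Y₁.indicator 1 ω')
                + (D₁.indicator (1 : Config E → R) ω' * C₁.indicator 1 ω
                  - X₁.indicator (1 : Config E → R) ω' * Y₁.indicator 1 ω))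
        + m₂ * ∑ ω, ∑ ω', weight (Function.update p e 1) ω * weight (Function.update p e 1) ω'
            * ((D₂.indicator (1 : Config E → R) ω * C₂.indicator 1 ω'
                  - X₂.indicator (1 : Config E → R) ω * Y₂.indicator 1 ω')
                + (D₂.indicator (1 : Config E → R) ω' * C₂.indicator 1 ω
                  - X₂.indicator (1 : Config E → R) ω' * Y₂.indicator 1 ω)) := by
    simp only [Finset.mul_sum]
    rw [← Finset.sum_add_distrib, ← Finset.sum_add_distrib, ← Finset.sum_add_distrib]
    refine Finset.sum_congr rfl fun ω _ => ?_
    rw [← Finset.sum_add_distrib, ← Finset.sum_add_distrib, ← Finset.sum_add_distrib]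
    refine Finset.sum_congr rfl fun ω' _ => ?_
    ring
  rw [hsplit] at hsum
  have := mul_nonneg hm₁ hA1
  have := mul_nonneg hm₂ hA2
  linarith

end AD

section Induction

variable {E : Type*} [Fintype E] [DecidableEq E] {R : Type*} [CommRing R] [LinearOrder R]
  [IsStrictOrderedRing R]

/-- **The certificate induction with Ahlswede–Daykin terms.** -/
theorem defect_nonneg_of_sym_certificates_ad
    (P : Set (Config E) → Set (Config E) → Set (Config E) → Set (Config E) → Prop)
    (hcert : ∀ (G H M B : Set (Config E)), P G H M B →
      ∀ p : E → R, IsProbVec p → (unpinned p).Nonempty →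
        ∃ e ∈ unpinned p, ∃ (G₁ H₁ M₁ B₁ G₂ H₂ M₂ B₂ X₁ Y₁ C₁ D₁ X₂ Y₂ C₂ D₂ : Set (Config E))
          (l₁ l₂ m₁ m₂ : R),
          P G₁ H₁ M₁ B₁ ∧ P G₂ H₂ M₂ B₂ ∧ 0 ≤ l₁ ∧ 0 ≤ l₂ ∧ 0 ≤ m₁ ∧ 0 ≤ m₂ ∧
          (∀ a ∈ X₁, ∀ b ∈ Y₁, a ⊓ b ∈ C₁ ∧ a ⊔ b ∈ D₁) ∧
          (∀ a ∈ X₂, ∀ b ∈ Y₂, a ⊓ b ∈ C₂ ∧ a ⊔ b ∈ D₂) ∧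
          ∀ ω ω' : Config E, ω e = true → ω' e = true →
            l₁ * (pairWt G₁ H₁ M₁ B₁ ω ω' + pairWt G₁ H₁ M₁ B₁ ω' ω)
              + l₂ * (pairWt G₂ H₂ M₂ B₂ ω ω' + pairWt G₂ H₂ M₂ B₂ ω' ω)
              + m₁ * ((D₁.indicator (1 : Config E → R) ω * C₁.indicator 1 ω'
                        - X₁.indicator (1 : Config E → R) ω * Y₁.indicator 1 ω')
                      + (D₁.indicator (1 : Config E → R) ω' * C₁.indicator 1 ω
                        - X₁.indicator (1 : Config E → R) ω' * Y₁.indicator 1 ω))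
              + m₂ * ((D₂.indicator (1 : Config E → R) ω * C₂.indicator 1 ω'
                        - X₂.indicator (1 : Config E → R) ω * Y₂.indicator 1 ω')
                      + (D₂.indicator (1 : Config E → R) ω' * C₂.indicator 1 ω
                        - X₂.indicator (1 : Config E → R) ω' * Y₂.indicator 1 ω))
              ≤ (pairWt G H M B (Function.update ω e false) ω'
                  + pairWt G H M B ω (Function.update ω' e false))
                + (pairWt G H M B (Function.update ω' e false) ω
                  + pairWt G H M B ω' (Function.update ω e false))) :
    ∀ (G H M B : Set (Config E)), P G H M B → ∀ p : E → R, IsProbVec p →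
      0 ≤ defect p G H M B := by
  classical
  suffices key : ∀ (n : ℕ) (p : E → R), IsProbVec p → (unpinned p).card = n →
      ∀ (G H M B : Set (Config E)), P G H M B → 0 ≤ defect p G H M B by
    intro G H M B hP p hp
    exact key _ p hp rfl G H M B hP
  intro n
  induction n using Nat.strong_induction_on with
  | _ n ih =>
    intro p hp hn G H M B hP
    by_cases hne : (unpinned p).Nonempty
    · obtain ⟨e, he, G₁, H₁, M₁, B₁, G₂, H₂, M₂, B₂, X₁, Y₁, C₁, D₁, X₂, Y₂, C₂, D₂, l₁, l₂, m₁, m₂,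
        hP₁, hP₂, hl₁, hl₂, hm₁, hm₂, hAD₁, hAD₂, hpt⟩ := hcert G H M B hP p hp hne
      have ha0 : 0 ≤ p e := hp.nonneg e
      have ha1 : 0 ≤ 1 - p e := sub_nonneg.2 (hp.le_one e)
      have hcard : ((unpinned p).erase e).card < n := by
        rw [← hn]; exact Finset.card_erase_lt_of_mem he
      have hp1 : IsProbVec (Function.update p e 1) := hp.update e zero_le_one le_rfl
      have hp0 : IsProbVec (Function.update p e 0) := hp.update e le_rfl zero_le_one
      have hc1 : (unpinned (Function.update p e 1)).card = ((unpinned p).erase e).card := by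
        rw [unpinned_update p he 1 (Or.inr rfl)]
      have hc0 : (unpinned (Function.update p e 0)).card = ((unpinned p).erase e).card := by
        rw [unpinned_update p he 0 (Or.inl rfl)]
      have h1 : 0 ≤ defect (Function.update p e 1) G H M B := ih _ hcard _ hp1 hc1 G H M B hP
      have h0 : 0 ≤ defect (Function.update p e 0) G H M B := ih _ hcard _ hp0 hc0 G H M B hP
      have hJ1 : 0 ≤ defect (Function.update p e 1) G₁ H₁ M₁ B₁ :=
        ih _ hcard _ hp1 hc1 G₁ H₁ M₁ B₁ hP₁
      have hJ2 : 0 ≤ defect (Function.update p e 1) G₂ H₂ M₂ B₂ :=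
        ih _ hcard _ hp1 hc1 G₂ H₂ M₂ B₂ hP₂
      have hX2 := crossTerm_ge_of_pointwise_sym_ad hp e G H M B G₁ H₁ M₁ B₁ G₂ H₂ M₂ B₂
        X₁ Y₁ C₁ D₁ X₂ Y₂ C₂ D₂ hAD₁ hAD₂ l₁ l₂ m₁ m₂ hm₁ hm₂ hpt
      have hX : 0 ≤ crossTerm p e G H M B := by
        have := mul_nonneg hl₁ hJ1
        have := mul_nonneg hl₂ hJ2
        linarith
      rw [defect_eq_pin_cross p G H M B e]
      have := mul_nonneg (mul_nonneg ha0 ha1) hX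
      have := mul_nonneg (pow_nonneg ha0 2) h1
      have := mul_nonneg (pow_nonneg ha1 2) h0
      linarith
    · have hpin : ∀ e, p e = 0 ∨ p e = 1 := fun e => by
        by_contra hcon
        refine hne ⟨e, ?_⟩
        simp only [unpinned, Finset.mem_filter, Finset.mem_univ, true_and]
        exact ⟨fun h => hcon (Or.inl h), fun h => hcon (Or.inr h)⟩
      rw [defect_eq_zero_of_pinned p hpin]

end Induction

end ThreeEvent

end Summit.Ventures.PercRepro2
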